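import Summits.HodgeConjecture.HodgeConjecture.Theses.DeltaPeriodAudit

/-!
# Route DeltaPeriodAudit — `EigenlineCMCriterion` (support item stmt-HodgeConjecture-2367)

For `τ` on the imaginary axis, `τ = it` with `t ≠ 0`: the line `ℂ·(τ, 1)` is an eigenline of some
NON-SCALAR rational `2 × 2` matrix iff `τ² ∈ ℚ` (the CM criterion for the lattice `ℤ + ℤτ`).
`⇐`: `(0 q; 1 0)` has `(τ, 1)` as eigenvector with eigenvalue `τ` when `τ² = q`.  `⇒`: an eigen-relation
`(a b; c d)(τ,1)ᵀ = μ (τ,1)ᵀ` gives `cτ² + (d - a)τ - b = 0`; with `τ = it`, `τ² = -t²` is real, so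
`(d - a)t = 0`, i.e. `d = a`, and `b = -ct²`; if `c ≠ 0` then `τ² = b/c ∈ ℚ`, and if `c = 0` the matrix
is the scalar `a`.  Elementary; no named-fact hypothesis, no sorry.
-/

-- `Summit.HodgeConjecture.HodgeConjecture.Theorems` is the mandated namespace (single-problem
-- summit: Problem = Summit), which `linter.dupNamespace` flags on every declaration; the lakefile
-- turns the linter off tree-wide (weak option), restated here so stand-alone elaboration is
-- warning-free too.
set_option linter.dupNamespace false

namespace Summit.HodgeConjecture.HodgeConjecture.Theorems

/-- **Item stmt-HodgeConjecture-2367 (`EigenlineCMCriterion`), route `DeltaPeriodAudit`**: on the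
imaginary axis, `(τ, 1)` spans an eigenline of a non-scalar rational matrix iff `τ²` is rational.
[cite: Shimura1977, §1] -/
theorem deltaPeriodAudit_eigenlineCMCriterion_proof :
    Summit.HodgeConjecture.HodgeConjecture.Theses.DeltaPeriodAudit.EigenlineCMCriterion := by
  intro τ hre him
  have hτ : τ = (τ.im : ℂ) * Complex.I := Complex.ext (by simp [hre]) (by simp)
  constructor
  · rintro ⟨A, hA, μ, hμ⟩
    have h0 := congrFun hμ 0
    have h1 := congrFun hμ 1
    simp only [Matrix.mulVec, dotProduct, Fin.sum_univ_two, Matrix.map_apply,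
      Matrix.cons_val_zero, Matrix.cons_val_one, Pi.smul_apply, smul_eq_mul, mul_one] at h0 h1
    -- `h0 : a τ + b = μ τ`, `h1 : c τ + d = μ`
    set t : ℝ := τ.im with ht
    have key : ((A 0 1 : ℚ) : ℂ) + ((A 1 0 : ℚ) : ℂ) * (t : ℂ) ^ 2 +
        (((A 0 0 : ℚ) : ℂ) * t - ((A 1 1 : ℚ) : ℂ) * t) * Complex.I = 0 := by
      rw [← h1, hτ] at h0
      linear_combination h0 + ((A 1 0 : ℚ) : ℂ) * (t : ℂ) ^ 2 * Complex.I_sq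
    have key' : (((A 0 1 : ℝ) + (A 1 0 : ℝ) * t ^ 2 : ℝ) : ℂ) +
        (((A 0 0 : ℝ) * t - (A 1 1 : ℝ) * t : ℝ) : ℂ) * Complex.I = 0 := by
      push_cast
      linear_combination key
    have hx : (A 0 1 : ℝ) + (A 1 0 : ℝ) * t ^ 2 = 0 := by
      have h := congrArg Complex.re key'
      simp only [Complex.add_re, Complex.ofReal_re, Complex.mul_re, Complex.ofReal_im, Complex.I_re,
        Complex.I_im, mul_zero, zero_mul, sub_zero, add_zero, Complex.zero_re] at h
      exact h
    have hy : (A 0 0 : ℝ) * t - (A 1 1 : ℝ) * t = 0 := by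
      have h := congrArg Complex.im key'
      simp only [Complex.add_im, Complex.ofReal_im, Complex.mul_im, Complex.ofReal_re, Complex.I_re,
        Complex.I_im, mul_one, mul_zero, add_zero, zero_add, Complex.zero_im] at h
      exact h
    have ht0 : t ≠ 0 := him
    have had : (A 0 0 : ℝ) = A 1 1 := by
      have h : ((A 0 0 : ℝ) - A 1 1) * t = 0 := by rw [sub_mul]; exact hy
      rcases mul_eq_zero.1 h with h | h
      · exact sub_eq_zero.1 h
      · exact absurd h ht0
    by_cases hc : A 1 0 = 0
    · -- scalar matrix: contradiction
      exfalso
      have hb : A 0 1 = 0 := by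
        have h : (A 0 1 : ℝ) = 0 := by simpa [hc] using hx
        exact_mod_cast h
      have had' : A 1 1 = A 0 0 := by exact_mod_cast had.symm
      refine hA (A 0 0) (Matrix.ext fun i j ↦ ?_)
      fin_cases i <;> fin_cases j <;> simp [hb, hc, had']
    · refine ⟨A 0 1 / A 1 0, ?_⟩
      have hcR : (A 1 0 : ℝ) ≠ 0 := by exact_mod_cast hc
      have ht2 : t ^ 2 = -(A 0 1 : ℝ) / A 1 0 := by
        field_simp
        linarith [hx]
      rw [hτ]
      calc ((t : ℂ) * Complex.I) ^ 2 = ((t ^ 2 : ℝ) : ℂ) * Complex.I ^ 2 := by push_cast; ring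
        _ = ((-(A 0 1 : ℝ) / A 1 0 : ℝ) : ℂ) * (-1) := by rw [ht2, Complex.I_sq]
        _ = ((A 0 1 / A 1 0 : ℚ) : ℂ) := by push_cast; ring
  · rintro ⟨q, hq⟩
    refine ⟨!![0, q; 1, 0], fun c hc ↦ ?_, τ, ?_⟩
    · have h := congrFun (congrFun hc 1) 0
      simp at h
    · ext i
      fin_cases i <;>
        simp [Matrix.mulVec, dotProduct, Fin.sum_univ_two, hq.symm, pow_two]

end Summit.HodgeConjecture.HodgeConjecture.Theorems
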